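import Summits.Langlands.Langlands.Theorems.IrreducibilityBySelfDualityIrreducibleOffSectorOfArithmetic
import Summits.Langlands.Langlands.Theorems.IrreducibilityBySelfDualityIrreducibleOffSectorRankThreeRational
import HarnessLib

/-!
# `IrreducibleOffSector` in rank three from L-arithmeticity of `π`, off the essentially self-dual locus
(crux stmt-Langlands-14329 `IrreducibilityBySelfDuality.IrreducibleOffSector`, line `Sketch`;
`--supports` file, STRUCTURAL: no import of the route module)

The rank-three companion of `isIrreducible_rank_two_of_isLArithmetic` (`…OfArithmetic`): for ANY
number field `K` and ANY cuspidal `π` on `GL_3(𝔸_K)` that is not essentially self-dual at Satake level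
and is L-ARITHMETIC at almost all unramified places (`e_i(t_{π,v}) ∈ E`, `E ⊂ ℂ` a number field;
Buzzard–Gee 2014 Def. 3.1.4 / Conj. 3.1.6), every a.e.-compatible `ρ : Γ_K → GL_3(ℚ̄_ℓ)` is
irreducible — `ρ` itself is an `E`-rational avatar (`eventually_rational_of_esymm_mem`), so
`isIrreducible_rank_three_of_not_essSelfDual_of_exists_rational` (p117816) applies.  Modulo the
`WeakAbelianSummandHecke` text and Arthur–Clozel (2.2) only.

References: K. Buzzard, T. Gee, LMS LNS 414 (2014), Def. 3.1.4, Conj. 3.1.6; G. Böckle, C.-Y. Hui,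
Math. Ann. 393 (2025), Thm. 1.1, §3.2.1.
-/

noncomputable section

set_option linter.dupNamespace false

open scoped NumberField Classical Polynomial
open Filter IsDedekindDomain NumberField Polynomial
open Literature.NumberTheory.Automorphic Literature.NumberTheory.GaloisRepresentations
open Summit.Langlands

namespace Summit.Langlands.Langlands.Theorems.IrreducibleOffSector

/-- **Rank three, off the essentially self-dual locus: L-arithmetic cuspidal `π` have irreducible
avatars** (every number field `K`, EVERY cuspidal `π` on `GL_3(𝔸_K)` that is not essentially
self-dual at Satake level and whose unramified Hecke eigenvalues lie in a number field at almost all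
places; no archimedean hypothesis).  Grant the `WeakAbelianSummandHecke` text and Arthur–Clozel
(2.2).  Then every `ρ : Γ_K → GL_3(ℚ̄_ℓ)` Satake–Frobenius compatible with `(π, ι)` at almost all
places is irreducible (`isIrreducible_rank_three_of_not_essSelfDual_of_exists_rational` with the
`E`-rational avatar `ρ₀ := ρ`). [cite: BockleHui2025, Theorem 1.1 and §3.2.1]
[cite: BuzzardGeeLMS2014, Def. 3.1.4] -/
theorem isIrreducible_rank_three_of_not_essSelfDual_of_isLArithmetic
    (hWA : ∀ (K : Type) [Field K] [NumberField K] (h1 : isCompact_glFiniteIntegralLevel 1 K) (ℓ : ℕ) [Fact ℓ.Prime] (n : ℕ) (E : Type) [Field E] [NumberField E] (e : E →+* PadicAlgCl ℓ) (ρ : Literature.NumberTheory.GaloisRepresentations.FramedGaloisRep K (PadicAlgCl ℓ) n), ρ.toGaloisRep.IsSemisimple → (∀ᶠ v in cofinite, ρ.IsUnramifiedAt v ∧ ∃ P : Polynomial E, ρ.HasFrobCharpolyAt v (P.map e)) → ∀ (ψ : Literature.NumberTheory.GaloisRepresentations.FramedGaloisRep K (PadicAlgCl ℓ) 1), (∀ᶠ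 v in cofinite, ρ.IsUnramifiedAt v ∧ ψ.IsUnramifiedAt v ∧ ∀ 𝔓 ∈ v.primesAbove, ∀ σ : Field.absoluteGaloisGroup K, IsArithFrobAt (NumberField.RingOfIntegers K) σ 𝔓 → ψ.charpoly σ ∣ ρ.charpoly σ) → ∀ (ι : PadicAlgCl ℓ ≃+* ℂ), ∃ χ : Literature.NumberTheory.Automorphic.CuspidalAutomorphicRepData 1 K h1, χ.1.IsRegularAlgebraic ∧ ∀ᶠ v in cofinite, ∃ c : ℂ, χ.1.HasSatakeParamAt v {c} ∧ ψ.IsUnramifiedAt v ∧ ψ.HasFrobCharpolyAt v (Literature.NumberTheory.Automorphic.arithFrobPolyOfSatake ι v.residueCard 1 {c}))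
    (h22 : JacquetShalika1981_partialPairL_boundary_repData)
    {K : Type} [Field K] [NumberField K] (h1 : isCompact_glFiniteIntegralLevel 1 K)
    {hcpt : isCompact_glFiniteIntegralLevel 3 K} (π : CuspidalAutomorphicRepData 3 K hcpt)
    (hnsd : ∀ η : CuspidalAutomorphicRepData 1 K h1,
      ¬ ∀ᶠ v : HeightOneSpectrum (𝓞 K) in cofinite, ∀ α : Multiset ℂ, π.1.HasSatakeParamAt v α →
        ∃ c : ℂ, η.1.HasSatakeParamAt v {c} ∧ α.map (fun a => a⁻¹) = α.map (fun a => c * a))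
    (hE : ∃ E : Subfield ℂ, FiniteDimensional ℚ E ∧
      ∀ᶠ v : HeightOneSpectrum (𝓞 K) in cofinite, ∀ α : Multiset ℂ, π.1.HasSatakeParamAt v α →
        ∀ i ≤ 3, α.esymm i ∈ E)
    {ℓ : ℕ} [Fact ℓ.Prime] (ι : PadicAlgCl ℓ ≃+* ℂ) (ρ : FramedGaloisRep K (PadicAlgCl ℓ) 3)
    (hρ : ∀ᶠ v : HeightOneSpectrum (𝓞 K) in cofinite, SatakeFrobCompatibleAt ι π.1 ρ v) :
    ρ.toGaloisRep.IsIrreducible := by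
  obtain ⟨E, hfd, hE⟩ := hE
  haveI : FiniteDimensional ℚ E := hfd
  haveI : NumberField E := NumberField.mk
  exact isIrreducible_rank_three_of_not_essSelfDual_of_exists_rational hWA h22 h1 π hnsd ι
    ((ι.symm : ℂ ≃+* PadicAlgCl ℓ).toRingHom.comp E.subtype) hρ
    (eventually_rational_of_esymm_mem π.1 ι E hE ρ hρ) ρ hρ

end Summit.Langlands.Langlands.Theorems.IrreducibleOffSector

end
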